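import Summits.QuantumFields.YangMills.Theorems.AlphaInputsT3ACv3OuterPartX
import Summits.QuantumFields.YangMills.Theorems.AlphaInputsT3ACv3RegionProp2
import Literature.MathematicalPhysics.QuantumFieldTheory.Balaban1983to89.B8Prop7AdmittedFamily
import HarnessLib

/-!
# `AlphaInputsT3ACv3ProfileRegionR3` — STRATEGY B for 2′: (R3P) DISCHARGED — r3 FOR THE ENLARGED-REGION PROFILE ON THE `Λ_i(h)` from [B7] Prop. 2 ON A REGION
# (this seat's `BoxStokes.dist1_iter_blockAvg_lt_region`) and the STRICT fine bound under a corner in `Ω′_i(h)`; hence (OP) under the collar and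
# **(D6X) ⇐ (EL) + record sizes** — lane `pub-balaban3d`, seat alpha-2 (g4)

WHAT.  §1 (generic scales∕group) `abs_curl_potZE_mul_norm_le_of_corner` (the curl bound behind g3's `dist1_plaqVar_profE_le_of_corner`, exposed) and ★ `dist1_plaqVar_profE_lt_of_corner` — the
STRICT form `|profE(∂q) − 1| < ½C68·a_i·L^{−2i}` at a fine plaquette with a corner in `Ω′_i(h)` ([B5] (24) strict: `norm_exp_sub_one_lt_of_star_eq_neg`); §2 (T³) the nested site family
UNDER a read region `lam42 Ω(h) k i` (`regionSites`, block saturation) and ★★ `profileReg68LevelsT3_of_collar : CollarE … K → ProfileReg68LevelsT3` — Prop. 2 on the region with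
`α₀ := ½C68·a_i` gives `|((blockAvg ℰp)^s profE)(∂q) − 1| < C68·a_i·L^{−2(i−s)}` at every level-`s` plaquette with corners in `Λ_i(h)`, and `a_i = θBal(K−i)` (`T3Scales_gk_eq`);
§3 ★★ `outerPartsT3_of_collar'` ((OP) ⇐ (N2′) ∧ 4π ≤ C68), ★★★ `adaptedClassNonemptyT3X_of_innerLift_of_sizes'` — **(D6X) ⇐ (EL) `InnerExactLiftT3` ∧ `7L+3 ≤ M₁` ∧ `1 ≤ 2B₃` ∧
`4B₃L²·avgWindowFactor ≤ C68`**: the displayed kinematic row of 2′ over `𝒞_X` is reduced to the inner exact regular lift of the datum ALONE.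
HONEST FRAMING.  (EL) stays a hypothesis schema; nothing of [B10]∕[7]∕[4]'s estimates asserted beyond the tree's kernel Prop. 2; count-neutral helper toward R3 2′ (`stub_laneRecordsV3`,
items 19935∕19936); registry untouched; nothing about d = 4, the continuum, or a mass gap.

References: T. Bałaban, Commun. Math. Phys. 98 (1985) 17–51 [Balaban1985Averaging] ((24) p.21, Prop. 2 (52)–(54) p.26); CMP 102 (1985) 255–275 [Balaban1985UV3] ((68) p.273).
-/

set_option autoImplicit false

noncomputable section

/-! ## §1 The strict fine bound of the profile under a corner in an enlarged region -/

namespace Summit.QuantumFields.YangMills.Theorems.ProfileEnlarged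

open scoped Matrix.Norms.L2Operator
open NormedSpace
open Literature.MathematicalPhysics.QuantumFieldTheory.Balaban1983to89
open Literature.MathematicalPhysics.QuantumFieldTheory.Balaban1985CMP102
open Literature.MathematicalPhysics.QuantumFieldTheory.Balaban1985CMP102.Setting
open Summit.QuantumFields.Balaban3D.Carriers
open Summit.QuantumFields.Balaban3D.Proofs.Primitives (AlphaConsts)
open Summit.QuantumFields.YangMills.Theorems.BalabanUVNodesN08AlphaRegSel (plaqVar)
open Summit.QuantumFields.YangMills.Theorems.BalabanUVNodesN08AlphaAbelianLift
open Summit.QuantumFields.YangMills.Theorems.BalabanUVNodesN08AlphaAbelianAverage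
open Summit.QuantumFields.YangMills.Theorems.BalabanUVNodesN08AlphaPattern
open Summit.QuantumFields.YangMills.Theorems.BalabanUVNodesN08AlphaHistGeom
open Summit.QuantumFields.YangMills.Theorems.BalabanUVNodesN08AlphaBlend
open Summit.QuantumFields.YangMills.Theorems.BalabanUVNodesN08AlphaProfileBuild (aj aj_pos amp amp_nonneg amp_antitone two_mul_amp_mul_norm labZ)
open Literature.MathematicalPhysics.QuantumFieldTheory.Balaban1983to89.B8Prop7AdmittedFamily (norm_exp_sub_one_lt_of_star_eq_neg)

variable {L : ℕ} (S : Scales L) {G : Type} [GaugeGroup G] [MeasurableSpace G] {𝔊 : GroupModel G} (𝔠 : AlphaConsts L 𝔊.N)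
  {X : Matrix (Fin 𝔊.N) (Fin 𝔊.N) ℂ} {k : ℕ} (h : Hist S.P k) (hX : X ∈ 𝔊.lie)

/-- **THE CURL BOUND UNDER A CORNER IN `Ω′_i(h)`** (`i ≤ k ≤ K`, collars (N2′)): `|curl potZE (lab y; μ,ν)|·‖X‖ ≤ ½C68·a_i·L^{−2i}` — the middle of g3's
`dist1_plaqVar_profE_le_of_corner`, exposed (deepest enlarged region holding a corner, `abs_curl_potZE_le`, `amp` antitone). [cite: Balaban1985UV3, (68) p.273] -/
theorem abs_curl_potZE_mul_norm_le_of_corner (hX0 : X ≠ 0) (hk : k ≤ S.K) (hR : CollarE S 𝔠 k) (y : Site S.P 0) {μ ν : Fin S.P.d} (hμν : μ ≠ ν)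
    {i : ℕ} (hi : i ≤ k)
    (hcor : y ∈ OmegaE 𝔠.lane.carrier.M₁ (rcolOf S 𝔠.lane.carrier) k h i ∨ y.shift μ ∈ OmegaE 𝔠.lane.carrier.M₁ (rcolOf S 𝔠.lane.carrier) k h i ∨
      y.shift ν ∈ OmegaE 𝔠.lane.carrier.M₁ (rcolOf S 𝔠.lane.carrier) k h i ∨ (y.shift μ).shift ν ∈ OmegaE 𝔠.lane.carrier.M₁ (rcolOf S 𝔠.lane.carrier) k h i) :
    |curl (potZE S 𝔠 X h) (labZ y) μ ν| * ‖X‖ ≤ 𝔠.C68 / 2 * aj S 𝔠 i * (((L : ℝ) ^ i)⁻¹) ^ 2 := by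
  classical
  set P : ℕ → Prop := fun j => y ∈ OmegaE 𝔠.lane.carrier.M₁ (rcolOf S 𝔠.lane.carrier) k h j ∨
    y.shift μ ∈ OmegaE 𝔠.lane.carrier.M₁ (rcolOf S 𝔠.lane.carrier) k h j ∨ y.shift ν ∈ OmegaE 𝔠.lane.carrier.M₁ (rcolOf S 𝔠.lane.carrier) k h j ∨
    (y.shift μ).shift ν ∈ OmegaE 𝔠.lane.carrier.M₁ (rcolOf S 𝔠.lane.carrier) k h j with hPdef
  set js : ℕ := Nat.findGreatest P k with hjs_def
  have hjle : i ≤ js := Nat.le_findGreatest hi hcor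
  have hjsk : js ≤ k := Nat.findGreatest_le k
  have hspec := Nat.findGreatest_eq_iff.1 hjs_def.symm
  have hPjs : P js := by
    by_cases hz : js = 0
    · have hi0 : i = 0 := by omega
      rw [hz, ← hi0]; exact hcor
    · exact hspec.2.1 hz
  have hno : k ≤ js ∨ (y ∉ OmegaE 𝔠.lane.carrier.M₁ (rcolOf S 𝔠.lane.carrier) k h (js + 1) ∧
      y.shift μ ∉ OmegaE 𝔠.lane.carrier.M₁ (rcolOf S 𝔠.lane.carrier) k h (js + 1) ∧
      y.shift ν ∉ OmegaE 𝔠.lane.carrier.M₁ (rcolOf S 𝔠.lane.carrier) k h (js + 1)) := by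
    by_cases hk1 : k ≤ js
    · exact Or.inl hk1
    · right
      have hnot : ¬ P (js + 1) := hspec.2.2 (Nat.lt_succ_self js) (by omega)
      simp only [hPdef, not_or] at hnot
      exact ⟨hnot.1, hnot.2.1, hnot.2.2.1⟩
  have hbound : |curl (potZE S 𝔠 X h) (labZ y) μ ν| ≤ 2 * amp S 𝔠 X js := by
    rcases hPjs with hc | hc | hc | hc
    · exact abs_curl_potZE_le S 𝔠 h hX0 hk hR y hμν hjsk hc (Or.inl rfl) hno
    · exact abs_curl_potZE_le S 𝔠 h hX0 hk hR y hμν hjsk hc (Or.inr (Or.inl rfl)) hno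
    · exact abs_curl_potZE_le S 𝔠 h hX0 hk hR y hμν hjsk hc (Or.inr (Or.inr (Or.inl rfl))) hno
    · exact abs_curl_potZE_le S 𝔠 h hX0 hk hR y hμν hjsk hc (Or.inr (Or.inr (Or.inr rfl))) hno
  calc |curl (potZE S 𝔠 X h) (labZ y) μ ν| * ‖X‖ ≤ 2 * amp S 𝔠 X js * ‖X‖ := mul_le_mul_of_nonneg_right hbound (norm_nonneg X)
    _ ≤ 2 * amp S 𝔠 X i * ‖X‖ := by
        have := amp_antitone S 𝔠 hX0 hjle (by omega)
        have hXn : 0 ≤ ‖X‖ := norm_nonneg X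
        nlinarith
    _ = 𝔠.C68 / 2 * aj S 𝔠 i * (((L : ℝ) ^ i)⁻¹) ^ 2 := two_mul_amp_mul_norm S 𝔠 hX0 i

/-- **★ THE STRICT FINE BOUND**: a fine plaquette of `profE` with a corner in `Ω′_i(h)` (`i ≤ k ≤ K`, collars (N2′)) has `|profE(∂q) − 1| < ½C68·a_i·L^{−2i}` STRICTLY — the plaquette
variable is `exp(t·X)` with `‖t·X‖` at most the bound, and `‖e^{Y} − 1‖ < r` for skew-adjoint `Y` with `‖Y‖ ≤ r`, `r > 0` ([B5] (24) strict, `norm_exp_sub_one_lt_of_star_eq_neg`).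
[cite: Balaban1985Averaging, (24) p.21; Balaban1985UV3, (68) p.273] -/
theorem dist1_plaqVar_profE_lt_of_corner (hX0 : X ≠ 0) (hk : k ≤ S.K) (hR : CollarE S 𝔠 k) (y : Site S.P 0) {μ ν : Fin S.P.d} (hμν : μ ≠ ν)
    {i : ℕ} (hi : i ≤ k)
    (hcor : y ∈ OmegaE 𝔠.lane.carrier.M₁ (rcolOf S 𝔠.lane.carrier) k h i ∨ y.shift μ ∈ OmegaE 𝔠.lane.carrier.M₁ (rcolOf S 𝔠.lane.carrier) k h i ∨
      y.shift ν ∈ OmegaE 𝔠.lane.carrier.M₁ (rcolOf S 𝔠.lane.carrier) k h i ∨ (y.shift μ).shift ν ∈ OmegaE 𝔠.lane.carrier.M₁ (rcolOf S 𝔠.lane.carrier) k h i) :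
    dist1 (plaqVar (profE S 𝔠 h hX) y μ ν) < 𝔠.C68 / 2 * aj S 𝔠 i * (((L : ℝ) ^ i)⁻¹) ^ 2 := by
  haveI : NeZero 𝔊.N := ⟨Nat.pos_iff_ne_zero.mp 𝔊.N_pos⟩
  letI : CStarAlgebra (Matrix (Fin 𝔊.N) (Fin 𝔊.N) ℂ) := {}
  have hkm : k ≤ S.P.m + S.P.K := le_trans hk (Nat.le_add_left _ _)
  have hle := abs_curl_potZE_mul_norm_le_of_corner S 𝔠 h hX0 hk hR y hμν hi hcor
  set t : ℝ := curl (potZE S 𝔠 X h) (labZ y) μ ν with ht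
  have hr : 0 < 𝔠.C68 / 2 * aj S 𝔠 i * (((L : ℝ) ^ i)⁻¹) ^ 2 := by
    have := 𝔠.C68_pos
    have := aj_pos S 𝔠 (hi.trans hk)
    have hL : (0 : ℝ) < (L : ℝ) := by exact_mod_cast (zero_lt_one.trans S.hL.2)
    positivity
  rw [plaqVar_profE S 𝔠 h hX hkm, 𝔊.dist1_eq, UnitaryModel.opDist1, rho_gexp]
  have hstar : star ((((t : ℝ) : ℂ)) • X) = -((((t : ℝ) : ℂ)) • X) := by
    rw [star_smul, Matrix.star_eq_conjTranspose, Summit.QuantumFields.Balaban3D.Proofs.GroupModelSkew.conjTranspose_eq_neg_of_mem_lie 𝔊 hX,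
      Complex.star_def, Complex.conj_ofReal, smul_neg]
  refine norm_exp_sub_one_lt_of_star_eq_neg hstar hr ?_
  rw [norm_smul, Complex.norm_real, Real.norm_eq_abs]
  exact hle

end Summit.QuantumFields.YangMills.Theorems.ProfileEnlarged

/-! ## §2 The region under `Λ_i(h)` and r3 for the profile there -/

namespace Summit.QuantumFields.YangMills.Theorems

open Set
open scoped Matrix.Norms.L2Operator
open Literature.MathematicalPhysics.QuantumFieldTheory.Balaban1983to89
open Literature.MathematicalPhysics.QuantumFieldTheory.Balaban1983to89.ExpMeanLog (deltaSU expMeanLogSU)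
open Literature.MathematicalPhysics.QuantumFieldTheory.Balaban1983to89.T3ContinuumYM3Torus
open Literature.MathematicalPhysics.QuantumFieldTheory.Balaban1983to89.T3UnitLawDensityEML (ℰp)
open Literature.MathematicalPhysics.QuantumFieldTheory.Balaban1983to89.T3UnitScaleTilt (θBal)
open Literature.MathematicalPhysics.QuantumFieldTheory.Balaban1983to89.B10Eq38TorusDomains (plaqsIn toFine toFine_zero toFine_succ mem_plaqsIn_iff cornerSet)
open Literature.MathematicalPhysics.QuantumFieldTheory.Balaban1983to89.B10Eq42TorusConstraint (bondsIn lam42)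
open Literature.MathematicalPhysics.QuantumFieldTheory.Balaban1985CMP102.Setting
open Summit.QuantumFields.Balaban3D.Carriers
open Summit.QuantumFields.Balaban3D.Proofs.Primitives (AlphaConsts)
open Summit.QuantumFields.YangMills.Theorems.BalabanUVNodesN08AlphaProfileBuild (aj aj_pos)
open Summit.QuantumFields.YangMills.Theorems.BalabanUVNodesN08AlphaRegSel (plaqVar)
open Summit.QuantumFields.YangMills.Theorems.ProfileEnlarged (CollarE collarE_mono profE OmegaE Omega_subset_OmegaE dist1_plaqVar_profE_lt_of_corner)
open Summit.QuantumFields.YangMills.Theorems.BoxStokes (dist1_iter_blockAvg_lt_region)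

section T3

variable {F : T3Family} {𝔠 : AlphaConsts F.L (suGroupModel 2).N} {γ : ℝ} {hγ : 0 < γ} {hγ1 : γ ≤ (min 𝔠.gamma0 1) ^ 2} {K : ℕ}

/-- **THE SITES OF `T^{(t)}` UNDER THE READ REGION `lam42 Ω(h) k i`** (a nested family: `Λ_i(h)` ∕ `Ω_k(h)` is a union of blocks of every level `≤ i`). [cite: Balaban1985UV3, (42) p.266] -/
def AlphaInputsT3AC.regionSites (k : ℕ) (h : Hist (F.P K) k) (i : ℕ) : (t : ℕ) → Set (Site (F.P K) t) :=
  fun t => {z | toFine t z ∈ lam42 (Omega 𝔠.lane.carrier.M₁ (rcolOf (T3Scales F γ hγ (hγ1.trans (sq_min_one_le _ 𝔠.gamma0_pos)) K) 𝔠.lane.carrier) k h) k i}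

/-- **NESTING**: for `t < i ≤ k ≤ K`, a level-`t` site lies under the region iff its block does (block saturation, `mem_lam42_iff_of_coarsen_eq`). [cite: Balaban1985UV3, (39) p.266] -/
theorem AlphaInputsT3AC.regionSites_nested {k : ℕ} (hk : k ≤ K) (h : Hist (F.P K) k) {i : ℕ} (hik : i ≤ k) :
    ∀ t, t < i → ∀ z : Site (F.P K) t,
      z ∈ AlphaInputsT3AC.regionSites (𝔠 := 𝔠) (hγ := hγ) (hγ1 := hγ1) k h i t ↔
        blockOf z ∈ AlphaInputsT3AC.regionSites (𝔠 := 𝔠) (hγ := hγ) (hγ1 := hγ1) k h i (t + 1) := by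
  intro t hti z
  have hs1 : t + 1 ≤ (F.P K).m + (F.P K).K := (Nat.succ_le_of_lt (lt_of_lt_of_le hti hik)).trans (AlphaInputsT3AC.le_standing_of_le hk)
  have hs0 : t ≤ (F.P K).m + (F.P K).K := (Nat.le_succ t).trans hs1
  have key : coarsen (t + 1) (toFine t z) = coarsen (t + 1) (toFine (t + 1) (blockOf z)) := by
    rw [coarsen_succ, coarsen_toFine t hs0, coarsen_toFine (t + 1) hs1]
  exact mem_lam42_iff_of_coarsen_eq _ _ h (Nat.succ_le_of_lt hti) hik key

/-- `a_i = θ(K − i)` at the T³ scales: the profile's amplitude letter IS the route's window (`T3Scales_gk_eq`; the record's `b₀, p₀`). [cite: Balaban1985UV3, (7) p.257] -/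
theorem AlphaInputsT3AC.aj_T3_eq_θBal {i : ℕ} (hi : i ≤ K) :
    aj (T3Scales F γ hγ (hγ1.trans (sq_min_one_le _ 𝔠.gamma0_pos)) K) 𝔠 i = θBal F.L γ 𝔠.b₀ 𝔠.p₀ (K - i) := by
  show (T3Scales F γ hγ (hγ1.trans (sq_min_one_le _ 𝔠.gamma0_pos)) K).gk i *
      B10.pFun 𝔠.b₀ 𝔠.p₀ ((T3Scales F γ hγ (hγ1.trans (sq_min_one_le _ 𝔠.gamma0_pos)) K).gk i) = _
  rw [T3Scales_gk_eq F γ hγ _ K i hi]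
  rfl

/-- **★★ (R3P) FROM THE COLLAR ROW (N2′)**: r3 for the enlarged-region profile on every `Λ_i(h)`, `i < k` — [B7] Prop. 2 ON THE REGION under `Λ_i(h)` (`dist1_iter_blockAvg_lt_region`,
`α₀ := ½C68·a_i`, window from `b7WindowNear_T3`) fed by the STRICT fine bound (`dist1_plaqVar_profE_lt_of_corner`: every corner of a plaquette under `Λ_i(h)` lies in
`Ω_i(h) ⊆ Ω′_i(h)`): `|((blockAvg ℰp)^s profE)(∂q) − 1| < C68·a_i·(L^s/L^i)² = C68·θ(K−i)·L^{−2(i−s)}`. [cite: Balaban1985Averaging, Prop. 2 (52)–(54) p.26; Balaban1985UV3, (68) p.273] -/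
theorem AlphaInputsT3AC.profileReg68LevelsT3_of_collar (hN2 : CollarE (T3Scales F γ hγ (hγ1.trans (sq_min_one_le _ 𝔠.gamma0_pos)) K) 𝔠 K) :
    AlphaInputsT3AC.ProfileReg68LevelsT3 F 𝔠 γ hγ hγ1 K := by
  intro k hk h _ X hX hX0 i hik s hsi q hq
  set S : Scales F.L := T3Scales F γ hγ (hγ1.trans (sq_min_one_le _ 𝔠.gamma0_pos)) K with hS
  have hiK : i ≤ K := (Nat.le_of_lt hik).trans hk
  have hR : CollarE S 𝔠 k := collarE_mono S 𝔠 hN2 hk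
  have hkS : k ≤ S.K := hk
  have hi_std : i ≤ (F.P K).m + (F.P K).K := hiK.trans (AlphaInputsT3AC.le_standing_of_le le_rfl)
  -- the window for `α₀ := ½C68·a_i` (a fortiori from the full window)
  obtain ⟨hα, hα3, hα2, -⟩ := AlphaInputsT3AC.b7WindowNear_T3 (F := F) (𝔠 := 𝔠) (γ := γ) (hγ := hγ) (hγ1 := hγ1) (K := K) hiK
  set α₀ : ℝ := 𝔠.C68 * aj S 𝔠 i / 2 with hα₀
  have hα₀pos : 0 < α₀ := by positivity
  have hα₀le : α₀ ≤ 𝔠.C68 * aj S 𝔠 i := by rw [hα₀]; linarith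
  have hα3' : (143 * ((((( F.P K).d + 4 : ℕ) : ℝ)) ^ 2 / 4) ^ 2) * α₀ ≤ 1 / 3 := by
    have hd : (F.P K).d + 4 = 3 + 4 := rfl
    rw [hd]
    exact (mul_le_mul_of_nonneg_left hα₀le (by positivity)).trans hα3
  have hα2' : 2 * α₀ ≤ 2 * deltaSU (Fin 2) / ((((F.P K).d + 4) * (F.P K).L : ℕ) : ℝ) ^ 2 := by
    have hd : ((F.P K).d + 4) * (F.P K).L = (3 + 4) * F.L := rfl
    rw [hd]
    linarith
  -- the nested region under `Λ_i(h)` and the fine hypothesis (52), strict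
  have h52 : ∀ q₀ : Plaq (F.P K) 0, q₀.src ∈ AlphaInputsT3AC.regionSites (𝔠 := 𝔠) (hγ := hγ) (hγ1 := hγ1) k h i 0 →
      q₀.src.shift q₀.μ ∈ AlphaInputsT3AC.regionSites (𝔠 := 𝔠) (hγ := hγ) (hγ1 := hγ1) k h i 0 →
      q₀.src.shift q₀.ν ∈ AlphaInputsT3AC.regionSites (𝔠 := 𝔠) (hγ := hγ) (hγ1 := hγ1) k h i 0 →
      (q₀.src.shift q₀.μ).shift q₀.ν ∈ AlphaInputsT3AC.regionSites (𝔠 := 𝔠) (hγ := hγ) (hγ1 := hγ1) k h i 0 →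
      dist1 (GaugeField.plaqHol (profE S 𝔠 h hX) q₀) < α₀ * (((F.L : ℝ) ^ i)⁻¹) ^ 2 := by
    intro q₀ h0 _ _ _
    have hsrc : q₀.src ∈ OmegaE (S := S) 𝔠.lane.carrier.M₁ (rcolOf S 𝔠.lane.carrier) k h i :=
      Omega_subset_OmegaE (S := S) h i (lam42_subset_of_le _ (Nat.le_of_lt hik) h0)
    have hlt := dist1_plaqVar_profE_lt_of_corner S 𝔠 h hX hX0 hkS hR q₀.src (ne_of_lt q₀.hμν) (Nat.le_of_lt hik) (Or.inl hsrc)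
    have heq : α₀ * (((F.L : ℝ) ^ i)⁻¹) ^ 2 = 𝔠.C68 / 2 * aj S 𝔠 i * (((F.L : ℝ) ^ i)⁻¹) ^ 2 := by rw [hα₀]; ring
    rw [heq]
    exact hlt
  -- the four corners of `q` lie under the region
  have hc := mem_plaqsIn_iff.mp hq
  have h1 : q.src ∈ AlphaInputsT3AC.regionSites (𝔠 := 𝔠) (hγ := hγ) (hγ1 := hγ1) k h i s := hc (by simp [cornerSet])
  have h2 : q.src.shift q.μ ∈ AlphaInputsT3AC.regionSites (𝔠 := 𝔠) (hγ := hγ) (hγ1 := hγ1) k h i s := hc (by simp [cornerSet])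
  have h3 : q.src.shift q.ν ∈ AlphaInputsT3AC.regionSites (𝔠 := 𝔠) (hγ := hγ) (hγ1 := hγ1) k h i s := hc (by simp [cornerSet])
  have h4 : (q.src.shift q.μ).shift q.ν ∈ AlphaInputsT3AC.regionSites (𝔠 := 𝔠) (hγ := hγ) (hγ1 := hγ1) k h i s := hc (by simp [cornerSet])
  have hmain := dist1_iter_blockAvg_lt_region (n := Fin 2) i hi_std hα₀pos hα3' hα2'
    (AlphaInputsT3AC.regionSites (𝔠 := 𝔠) (hγ := hγ) (hγ1 := hγ1) k h i) (AlphaInputsT3AC.regionSites_nested (𝔠 := 𝔠) (hγ1 := hγ1) hk h (Nat.le_of_lt hik))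
    (U := profE S 𝔠 h hX) h52 hsi q h1 h2 h3 h4
  refine (le_of_lt hmain).trans (le_of_eq ?_)
  -- `2α₀·(L^s/L^i)² = C68·θ(K−i)·L^{−2(i−s)}`
  have hL : (0 : ℝ) < F.L := by exact_mod_cast (zero_lt_one.trans F.hL.2)
  have hpow : (F.L : ℝ) ^ s * ((F.L : ℝ) ^ i)⁻¹ = ((F.L : ℝ) ^ (i - s))⁻¹ := by
    have hi : (F.L : ℝ) ^ i = (F.L : ℝ) ^ s * (F.L : ℝ) ^ (i - s) := by rw [← pow_add, Nat.add_sub_cancel' hsi]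
    rw [hi, mul_inv, ← mul_assoc, mul_inv_cancel₀ (pow_ne_zero _ hL.ne'), one_mul]
  have haj := AlphaInputsT3AC.aj_T3_eq_θBal (𝔠 := 𝔠) (hγ := hγ) (hγ1 := hγ1) hiK
  change 2 * α₀ * ((F.L : ℝ) ^ s * ((F.L : ℝ) ^ i)⁻¹) ^ 2 = 𝔠.C68 * θBal F.L γ 𝔠.b₀ 𝔠.p₀ (K - i) * (((F.L : ℝ) ^ (i - s))⁻¹) ^ 2
  rw [hpow, hα₀, ← haj]
  ring

/-! ## §3 (OP) under the collar; (D6X) from (EL) and the record sizes -/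

/-- **★★ (OP) FROM THE COLLAR ROW (N2′) AND `4π ≤ C68`** (no further hypothesis). [cite: Balaban1985UV3, (67)–(68) p.273] -/
theorem AlphaInputsT3AC.outerPartsT3_of_collar' (hN2 : CollarE (T3Scales F γ hγ (hγ1.trans (sq_min_one_le _ 𝔠.gamma0_pos)) K) 𝔠 K) (hC : 4 * Real.pi ≤ 𝔠.C68) :
    AlphaInputsT3AC.OuterPartsT3 F 𝔠 γ hγ hγ1 K :=
  AlphaInputsT3AC.outerPartsT3_of_collar (hγ1 := hγ1) hN2 hC (AlphaInputsT3AC.profileReg68LevelsT3_of_collar (hγ1 := hγ1) hN2)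

/-- **★★ (D6X-CHARGED) FROM (EL), THE COLLAR ROW AND `4π ≤ C68`.** [cite: Balaban1985UV3, (40)–(42) p.266 + (67)–(68) p.273] -/
theorem AlphaInputsT3AC.adaptedClassNonemptyChargedT3X_of_innerLift_of_collar (hN2 : CollarE (T3Scales F γ hγ (hγ1.trans (sq_min_one_le _ 𝔠.gamma0_pos)) K) 𝔠 K)
    (hC : 4 * Real.pi ≤ 𝔠.C68) (hEL : AlphaInputsT3AC.InnerExactLiftT3 F 𝔠 γ hγ hγ1 K) :
    AlphaInputsT3AC.AdaptedClassNonemptyChargedT3X F 𝔠 γ hγ hγ1 K :=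
  AlphaInputsT3AC.adaptedClassNonemptyChargedT3X_of_innerLift (hγ1 := hγ1) hEL (AlphaInputsT3AC.outerPartsT3_of_collar' (hγ1 := hγ1) hN2 hC)

/-- **★★★ (D6X) FROM (EL) AND THE RECORD SIZES `7L + 3 ≤ M₁`, `1 ≤ 2B₃`, `4B₃L²·avgWindowFactor ≤ C68`**: the displayed kinematic row of 2′ over the seam-blind class is REDUCED to the
inner exact regular lift of the charged datum on `Ω_k(h)` ALONE. [cite: Balaban1985UV3, (7) p.257, (40)–(42) p.266, (67)–(68) p.273] -/
theorem AlphaInputsT3AC.adaptedClassNonemptyT3X_of_innerLift_of_sizes' (hM₁ : 7 * F.L + 3 ≤ 𝔠.M₁) (hB₃ : 1 ≤ 2 * 𝔠.B₃)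
    (hC : 4 * 𝔠.B₃ * (F.L : ℝ) ^ 2 * avgWindowFactor F.L ≤ 𝔠.C68) (hEL : AlphaInputsT3AC.InnerExactLiftT3 F 𝔠 γ hγ hγ1 K) :
    AlphaInputsT3AC.AdaptedClassNonemptyT3X F 𝔠 γ hγ hγ1 K :=
  AlphaInputsT3AC.adaptedClassNonemptyT3X_of_innerLift_of_sizes (hγ1 := hγ1) hM₁ hB₃ hC hEL
    (AlphaInputsT3AC.profileReg68LevelsT3_of_collar (hγ1 := hγ1) (AlphaInputsT3AC.collarE_T3_of_M₁_ge (hγ := hγ) (hγ1 := hγ1) (K := K) hM₁))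

end T3

end Summit.QuantumFields.YangMills.Theorems

end
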